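import Summits.QuantumFields.YangMills.Theorems.ColdStartUniversalityShenZhuZhuTalagrandSU2
import Summits.QuantumFields.YangMills.Theorems.ColdStartUniversalityLatticeLangevinStrongFellerTV
import Summits.QuantumFields.YangMills.Theorems.ColdStartUniversalityLatticeLangevinRiemannW1ContractionCouplings
import HarnessLib

/-!
# VOLUME-FREE TOTAL-VARIATION MIXING FROM WARM STARTS for the `SU(2)` lattice Langevin dynamics on `(ℤ/L)³`, `|β'| < 1/12`:
# `|νP_(t+s)(A) − μ_(β')(A)| ≤ C_s·e^{−(1−12|β'|)t}·√((2/(1−12|β'|))·KL(ν‖μ_(β')))` for every Borel `A`, every initial law `ν` of finite entropy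

Seat `ym-line-csu-p1` (g42), route `ColdStartUniversality` of `Summits/QuantumFields/YangMills`, helper file G73 (`--supports stmt-QuantumFields-24809`).
G67's every-start TV ergodicity carries the VOLUME-DEPENDENT prefactor `∫ρ_L(Q,·)dμ ≤ √2π√#E`.  For initial laws `ν` (instead of Dirac starts) the
prefactor becomes a transport distance: Chapman–Kolmogorov `κ_(t+s) = κ_s ∘ κ_t`, the set-wise strong Feller bound for `κ_s` (G67, `C_s`-Lipschitz
observable `y ↦ κ_s(y,A)`) and the all-Lipschitz `W₁` contraction of `κ_t` against a coupling (G56) give `|νP_(t+s)(A) − ν'P_(t+s)(A)| ≤ C_s e^{−ct}∫ρ_L dπ`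
for EVERY coupling `π` of `(ν, ν')`; Cauchy–Schwarz turns `∫ρ_L dπ` into `W₂`, and Talagrand's `T₂` (G70b) bounds `W₂(ν, μ_(β'))²` by
`(2/(1−12|β'|))·KL(ν‖μ_(β'))` — a TV mixing estimate whose constants do not see the volume.

* ★ `sq_integral_le_integral_sq` — `(∫f dπ)² ≤ ∫f² dπ` on a probability space (generic);
* ★★★ `wilson_tv_contraction_of_coupling` — `|(κ_(t+s)∘ν)(A) − (κ_(t+s)∘ν')(A)| ≤ C_s·e^{−(1−12|β'|)t}·∫ρ_L dπ` for every coupling `π` of `(ν,ν')`;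
* ★★★ `wilson_tv_contraction_szzWasserstein_W2` — `ofReal(|(κ_(t+s)∘ν)(A) − (κ_(t+s)∘ν')(A)|²/(C_s²e^{−2ct})) ≤ szzWassersteinSq ρ_L² ν ν'`;
* ★★★★ **`wilson_tv_ergodicity_of_klDiv`** — `|(κ_(t+s)∘ν)(A) − μ_(β')(A)| ≤ C_s·e^{−(1−12|β'|)t}·√(2·(1/(1−12|β'|))·KL(ν‖μ_(β')))`,
  `C_s = √((1−12|β'|)/(e^{2(1−12|β'|)s} − 1))`, every `L`.

THEOREMS ONLY, no definition, no sorry.  HONEST FRAMING: fixed cut-off, finite volume, `|β'| < 1/12`; "volume-free" = the constants do not depend on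
`L` (the entropy `KL(ν‖μ_(β'))` of course may); Dirac (cold) starts have infinite entropy and are covered by G67 instead; nothing `K`-uniform along
the route's scaling; `UniformColdStartMixing` (24809, ASIDE) is not restated; no crux, rung or summit statement is proved; the Yang–Mills mass gap
is NOT proved.
-/

set_option autoImplicit false

noncomputable section

namespace Summit.QuantumFields.YangMills.Theorems.ColdStartUniversality

open MeasureTheory ProbabilityTheory Matrix Complex Finset Filter Topology Set InformationTheory
open scoped ComplexConjugate BigOperators NNReal ENNReal
open Literature.Probability.Process Literature.MathematicalPhysics.QuantumFieldTheory
open Literature.MathematicalPhysics.QuantumLattice (fundamentalRep fundamentalLatticeRep continuous_fundamentalRep fundamentalRep_apply fundamentalLatticeRep_N)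
open Literature.Geometry.Riemannian (IsCoupling)

/-! ## §0. Cauchy–Schwarz in the form `(∫f)² ≤ ∫f²` -/

/-- ★ On a probability space, `(∫f dπ)² ≤ ∫f² dπ` for `f`, `f²` integrable (variance is non-negative). [folklore] -/
theorem sq_integral_le_integral_sq {Z : Type*} [MeasurableSpace Z] (π : Measure Z) [IsProbabilityMeasure π] {f : Z → ℝ}
    (hf : Integrable f π) (hf2 : Integrable (fun z => f z ^ 2) π) :
    (∫ z, f z ∂π) ^ 2 ≤ ∫ z, f z ^ 2 ∂π := by
  obtain ⟨m, hm⟩ : ∃ m : ℝ, m = ∫ z, f z ∂π := ⟨_, rfl⟩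
  rw [← hm]
  have h0 : 0 ≤ ∫ z, (f z - m) ^ 2 ∂π := integral_nonneg fun z => sq_nonneg _
  have he : ∫ z, (f z - m) ^ 2 ∂π = ∫ z, f z ^ 2 ∂π - 2 * m * ∫ z, f z ∂π + m ^ 2 := by
    have h1 : ∀ z, (f z - m) ^ 2 = f z ^ 2 - 2 * m * f z + m ^ 2 := fun z => by ring
    simp_rw [h1]
    have hA : Integrable (fun z => f z ^ 2 - 2 * m * f z) π := hf2.sub (hf.const_mul _)
    have hB : Integrable (fun z => 2 * m * f z) π := hf.const_mul _
    rw [integral_add hA (integrable_const _), integral_sub hf2 hB, integral_const_mul, integral_const, probReal_univ, one_smul]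
  rw [he, ← hm] at h0
  nlinarith

variable {L : ℕ} [NeZero L]

/-! ## §1. TV contraction from two initial laws, against a coupling -/

/-- ★★★ **TV contraction from initial laws, against a coupling.**  For `|β'| < 1/12`, every `L`, every realising kernel family `κ`, probability laws
`ν, ν'` of starts, every coupling `π` of `(ν,ν')`, every measurable `A`, `s > 0`, `t ≥ 0`:
`|(κ_(t+s) ∘ₘ ν)(A) − (κ_(t+s) ∘ₘ ν')(A)| ≤ √((1−12|β'|)/(e^{2(1−12|β'|)s} − 1))·e^{−(1−12|β'|)t}·∫ρ_L(z.1,z.2) dπ(z)`.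
[cite: ShenZhuZhu2022, Theorem 4.2 (4.5)] [cite: BakryGentilLedoux2014, Thm 9.7.2] -/
theorem wilson_tv_contraction_of_coupling (L : ℕ) [NeZero L] (β' : ℝ) (hβ : |β'| < 1 / 12)
    (κ : ℝ≥0 → Kernel (GaugeConfig 3 L (Matrix.specialUnitaryGroup (Fin 2) ℂ))
      (GaugeConfig 3 L (Matrix.specialUnitaryGroup (Fin 2) ℂ))) [∀ t, IsMarkovKernel (κ t)]
    (hreal : ∀ (t : ℝ≥0) (x : GaugeConfig 3 L (Matrix.specialUnitaryGroup (Fin 2) ℂ))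
        (Ω : Type) [MeasurableSpace Ω] (P : Measure Ω) [IsProbabilityMeasure P]
        (W : ℝ≥0 → Ω → (Edge 3 L × NoiseIdx 2 → ℝ)) (hW : IsFlatBrownian W P)
        (U : ℝ≥0 → Ω → GaugeConfig 3 L (Matrix.specialUnitaryGroup (Fin 2) ℂ)),
        (∀ ω, U 0 ω = x) →
        (latticeLangevinDynamics (fundamentalLatticeRep 2) β').IsSolution (fundamentalRep (Fin 2))
          hW.natFiltration P W U →
        κ t x = P.map (U t))
    (ν ν' : Measure (GaugeConfig 3 L (Matrix.specialUnitaryGroup (Fin 2) ℂ))) [IsProbabilityMeasure ν] [IsProbabilityMeasure ν']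
    {cpl : Measure (GaugeConfig 3 L (Matrix.specialUnitaryGroup (Fin 2) ℂ) × GaugeConfig 3 L (Matrix.specialUnitaryGroup (Fin 2) ℂ))}
    (hπ : IsCoupling ν ν' cpl)
    {A : Set (GaugeConfig 3 L (Matrix.specialUnitaryGroup (Fin 2) ℂ))} (hA : MeasurableSet A) {s : ℝ≥0} (hs : 0 < (s : ℝ)) (t : ℝ≥0) :
    |((κ (t + s) ∘ₘ ν) A).toReal - ((κ (t + s) ∘ₘ ν') A).toReal| ≤
      Real.sqrt ((1 - 12 * |β'|) / (Real.exp (2 * (1 - 12 * |β'|) * (s : ℝ)) - 1)) * Real.exp (-((1 - 12 * |β'|) * (t : ℝ))) *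
        ∫ z, Real.sqrt (torusRiemannDistSq (fundamentalLatticeRep 2) z.1 z.2) ∂cpl := by
  classical
  haveI := secondCountableTopology_su2
  haveI := borelSpace_config L
  -- the observable `G(y) = κ_s(y)(A)` is `C_s`-Lipschitz for `ρ_L`
  have hGlip : ∀ P P' : GaugeConfig 3 L (Matrix.specialUnitaryGroup (Fin 2) ℂ), |((κ s P') A).toReal - ((κ s P) A).toReal| ≤
      Real.sqrt ((1 - 12 * |β'|) / (Real.exp (2 * (1 - 12 * |β'|) * (s : ℝ)) - 1)) * Real.sqrt (torusRiemannDistSq (fundamentalLatticeRep 2) P P') :=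
    fun P P' => wilson_strongFeller_set L β' hβ κ hreal hA hs P P'
  have h := wilson_W1_contraction_of_coupling L (Real.sqrt_nonneg _) hGlip ν ν' hπ t β' hβ κ hreal
  -- Chapman–Kolmogorov: `(κ_(t+s) ∘ₘ m)(A) = ∫ κ_s(y)(A) d(κ_t ∘ₘ m)`
  have hCK : ∀ (m : Measure (GaugeConfig 3 L (Matrix.specialUnitaryGroup (Fin 2) ℂ))) [IsProbabilityMeasure m],
      ((κ (t + s) ∘ₘ m) A).toReal = ∫ y, ((κ s y) A).toReal ∂(κ t ∘ₘ m) := by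
    intro m _
    rw [chapmanKolmogorov_szz β' κ hreal t s, ← Measure.comp_assoc, Measure.bind_apply hA (κ s).measurable.aemeasurable,
      integral_toReal ((κ s).measurable_coe hA).aemeasurable (ae_of_all _ fun y => measure_lt_top _ _)]
  rw [hCK ν, hCK ν']
  calc _ ≤ _ := h
    _ = _ := by ring

/-! ## §2. Against `W₂` -/

/-- ★★★ **TV contraction from initial laws, against `W₂`.**  With `x = |(κ_(t+s)∘ν)(A) − (κ_(t+s)∘ν')(A)|` and `K = C_s²·e^{−2(1−12|β'|)t}`
(`C_s = √((1−12|β'|)/(e^{2(1−12|β'|)s} − 1))`):  `ofReal(x²/K) ≤ szzWassersteinSq ρ_L² ν ν'`, i.e. `x ≤ C_s e^{−(1−12|β'|)t}·W₂^{ρ_L}(ν,ν')`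
(§1 and Cauchy–Schwarz `∫ρ_L dπ ≤ (∫ρ_L² dπ)^{1/2}` for every coupling). [cite: ShenZhuZhu2022, Theorem 4.2 (4.5)] -/
theorem wilson_tv_contraction_szzWasserstein_W2 (L : ℕ) [NeZero L] (β' : ℝ) (hβ : |β'| < 1 / 12)
    (κ : ℝ≥0 → Kernel (GaugeConfig 3 L (Matrix.specialUnitaryGroup (Fin 2) ℂ))
      (GaugeConfig 3 L (Matrix.specialUnitaryGroup (Fin 2) ℂ))) [∀ t, IsMarkovKernel (κ t)]
    (hreal : ∀ (t : ℝ≥0) (x : GaugeConfig 3 L (Matrix.specialUnitaryGroup (Fin 2) ℂ))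
        (Ω : Type) [MeasurableSpace Ω] (P : Measure Ω) [IsProbabilityMeasure P]
        (W : ℝ≥0 → Ω → (Edge 3 L × NoiseIdx 2 → ℝ)) (hW : IsFlatBrownian W P)
        (U : ℝ≥0 → Ω → GaugeConfig 3 L (Matrix.specialUnitaryGroup (Fin 2) ℂ)),
        (∀ ω, U 0 ω = x) →
        (latticeLangevinDynamics (fundamentalLatticeRep 2) β').IsSolution (fundamentalRep (Fin 2))
          hW.natFiltration P W U →
        κ t x = P.map (U t))
    (ν ν' : Measure (GaugeConfig 3 L (Matrix.specialUnitaryGroup (Fin 2) ℂ))) [IsProbabilityMeasure ν] [IsProbabilityMeasure ν']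
    {A : Set (GaugeConfig 3 L (Matrix.specialUnitaryGroup (Fin 2) ℂ))} (hA : MeasurableSet A) {s : ℝ≥0} (hs : 0 < (s : ℝ)) (t : ℝ≥0) :
    ENNReal.ofReal (|((κ (t + s) ∘ₘ ν) A).toReal - ((κ (t + s) ∘ₘ ν') A).toReal| ^ 2 /
        ((1 - 12 * |β'|) / (Real.exp (2 * (1 - 12 * |β'|) * (s : ℝ)) - 1) * Real.exp (-(2 * (1 - 12 * |β'|) * (t : ℝ))))) ≤
      szzWassersteinSq (torusRiemannDistSq (fundamentalLatticeRep 2)) ν ν' := by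
  classical
  haveI := secondCountableTopology_su2
  haveI := borelSpace_config L
  have hc : 0 < 1 - 12 * |β'| := by linarith
  -- the constants
  obtain ⟨Cs, hCs⟩ : ∃ Cs : ℝ, Cs = Real.sqrt ((1 - 12 * |β'|) / (Real.exp (2 * (1 - 12 * |β'|) * (s : ℝ)) - 1)) := ⟨_, rfl⟩
  have hden : 0 < Real.exp (2 * (1 - 12 * |β'|) * (s : ℝ)) - 1 := by
    have : 1 < Real.exp (2 * (1 - 12 * |β'|) * (s : ℝ)) := Real.one_lt_exp_iff.2 (by positivity)
    linarith
  have hCs2 : Cs ^ 2 = (1 - 12 * |β'|) / (Real.exp (2 * (1 - 12 * |β'|) * (s : ℝ)) - 1) := by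
    rw [hCs, Real.sq_sqrt (div_pos hc hden).le]
  have hCs0 : 0 < Cs := by rw [hCs]; exact Real.sqrt_pos.2 (div_pos hc hden)
  have hE2 : Real.exp (-((1 - 12 * |β'|) * (t : ℝ))) ^ 2 = Real.exp (-(2 * (1 - 12 * |β'|) * (t : ℝ))) := by
    rw [sq, ← Real.exp_add]; ring_nf
  have hK : (1 - 12 * |β'|) / (Real.exp (2 * (1 - 12 * |β'|) * (s : ℝ)) - 1) * Real.exp (-(2 * (1 - 12 * |β'|) * (t : ℝ))) =
      (Cs * Real.exp (-((1 - 12 * |β'|) * (t : ℝ)))) ^ 2 := by rw [mul_pow, hCs2, hE2]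
  have hK0 : 0 < Cs * Real.exp (-((1 - 12 * |β'|) * (t : ℝ))) := mul_pos hCs0 (Real.exp_pos _)
  rw [hK]
  refine le_iInf fun q => ?_
  obtain ⟨cpl, hπ⟩ := q
  haveI : IsProbabilityMeasure cpl := hπ.1
  have h1 := wilson_tv_contraction_of_coupling L β' hβ κ hreal ν ν' hπ hA hs t
  rw [← hCs] at h1
  -- Cauchy–Schwarz
  have hρc : Continuous fun z : GaugeConfig 3 L (Matrix.specialUnitaryGroup (Fin 2) ℂ) × GaugeConfig 3 L (Matrix.specialUnitaryGroup (Fin 2) ℂ) =>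
      Real.sqrt (torusRiemannDistSq (fundamentalLatticeRep 2) z.1 z.2) := Real.continuous_sqrt.comp continuous_torusRiemannDistSq_two
  have hρi : Integrable (fun z : GaugeConfig 3 L (Matrix.specialUnitaryGroup (Fin 2) ℂ) × GaugeConfig 3 L (Matrix.specialUnitaryGroup (Fin 2) ℂ) =>
      Real.sqrt (torusRiemannDistSq (fundamentalLatticeRep 2) z.1 z.2)) cpl := hρc.integrable_of_hasCompactSupport (HasCompactSupport.of_compactSpace _)
  have hρ2i : Integrable (fun z : GaugeConfig 3 L (Matrix.specialUnitaryGroup (Fin 2) ℂ) × GaugeConfig 3 L (Matrix.specialUnitaryGroup (Fin 2) ℂ) =>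
      Real.sqrt (torusRiemannDistSq (fundamentalLatticeRep 2) z.1 z.2) ^ 2) cpl := (hρc.pow 2).integrable_of_hasCompactSupport (HasCompactSupport.of_compactSpace _)
  have hnn : ∀ z : GaugeConfig 3 L (Matrix.specialUnitaryGroup (Fin 2) ℂ) × GaugeConfig 3 L (Matrix.specialUnitaryGroup (Fin 2) ℂ),
      0 ≤ torusRiemannDistSq (fundamentalLatticeRep 2) z.1 z.2 := fun z => by
    unfold torusRiemannDistSq; exact Finset.sum_nonneg fun _ _ => sq_nonneg _
  have hCSz := sq_integral_le_integral_sq cpl hρi hρ2i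
  have hsq : ∫ z, Real.sqrt (torusRiemannDistSq (fundamentalLatticeRep 2) z.1 z.2) ^ 2 ∂cpl = ∫ z, torusRiemannDistSq (fundamentalLatticeRep 2) z.1 z.2 ∂cpl :=
    integral_congr_ae (ae_of_all _ fun z => Real.sq_sqrt (hnn z))
  rw [hsq] at hCSz
  -- `x² ≤ K (∫ρ)² ≤ K ∫ρ²`
  have hx0 : 0 ≤ |((κ (t + s) ∘ₘ ν) A).toReal - ((κ (t + s) ∘ₘ ν') A).toReal| := abs_nonneg _
  have hI0 : 0 ≤ ∫ z, Real.sqrt (torusRiemannDistSq (fundamentalLatticeRep 2) z.1 z.2) ∂cpl := integral_nonneg fun _ => Real.sqrt_nonneg _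
  have h2 : |((κ (t + s) ∘ₘ ν) A).toReal - ((κ (t + s) ∘ₘ ν') A).toReal| ^ 2 ≤
      (Cs * Real.exp (-((1 - 12 * |β'|) * (t : ℝ)))) ^ 2 * ∫ z, torusRiemannDistSq (fundamentalLatticeRep 2) z.1 z.2 ∂cpl := by
    calc _ ≤ (Cs * Real.exp (-((1 - 12 * |β'|) * (t : ℝ))) * ∫ z, Real.sqrt (torusRiemannDistSq (fundamentalLatticeRep 2) z.1 z.2) ∂cpl) ^ 2 :=
          pow_le_pow_left₀ hx0 h1 2
      _ = (Cs * Real.exp (-((1 - 12 * |β'|) * (t : ℝ)))) ^ 2 * (∫ z, Real.sqrt (torusRiemannDistSq (fundamentalLatticeRep 2) z.1 z.2) ∂cpl) ^ 2 := by ring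
      _ ≤ _ := mul_le_mul_of_nonneg_left hCSz (sq_nonneg _)
  have h3 : |((κ (t + s) ∘ₘ ν) A).toReal - ((κ (t + s) ∘ₘ ν') A).toReal| ^ 2 / (Cs * Real.exp (-((1 - 12 * |β'|) * (t : ℝ)))) ^ 2 ≤
      ∫ z, torusRiemannDistSq (fundamentalLatticeRep 2) z.1 z.2 ∂cpl := by
    rw [div_le_iff₀ (pow_pos hK0 2)]; linarith
  have hρ2i' : Integrable (fun z : GaugeConfig 3 L (Matrix.specialUnitaryGroup (Fin 2) ℂ) × GaugeConfig 3 L (Matrix.specialUnitaryGroup (Fin 2) ℂ) =>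
      torusRiemannDistSq (fundamentalLatticeRep 2) z.1 z.2) cpl := continuous_torusRiemannDistSq_two.integrable_of_hasCompactSupport (HasCompactSupport.of_compactSpace _)
  calc ENNReal.ofReal (|((κ (t + s) ∘ₘ ν) A).toReal - ((κ (t + s) ∘ₘ ν') A).toReal| ^ 2 / (Cs * Real.exp (-((1 - 12 * |β'|) * (t : ℝ)))) ^ 2)
        ≤ ENNReal.ofReal (∫ z, torusRiemannDistSq (fundamentalLatticeRep 2) z.1 z.2 ∂cpl) := ENNReal.ofReal_le_ofReal h3
    _ = ∫⁻ z, ENNReal.ofReal (torusRiemannDistSq (fundamentalLatticeRep 2) z.1 z.2) ∂cpl :=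
        ofReal_integral_eq_lintegral_ofReal hρ2i' (ae_of_all _ hnn)

/-! ## §3. Entropic total-variation mixing -/

/-- ★★★★ **Volume-free total-variation mixing from warm starts.**  For `|β'| < 1/12`, every `L`, every realising kernel family `κ` of the `SU(2)`
lattice Langevin dynamics, every initial law `ν` with `KL(ν‖μ_(β')) < ∞`, every measurable `A`, `s > 0` and `t ≥ 0`:
`|(κ_(t+s) ∘ₘ ν)(A) − μ_(β')(A)| ≤ √((1−12|β'|)/(e^{2(1−12|β'|)s} − 1))·e^{−(1−12|β'|)t}·√(2·(1/(1−12|β'|))·KL(ν‖μ_(β')))`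
(§2 with `ν' = μ_(β')` invariant, and Talagrand's `T₂`, G70b).  The constants do not depend on `L`.  The Yang–Mills mass gap is NOT proved.
[cite: ShenZhuZhu2022, Theorem 4.2 (4.5)] [cite: BakryGentilLedoux2014, Thm 9.6.1] -/
theorem wilson_tv_ergodicity_of_klDiv (L : ℕ) [NeZero L] (β' : ℝ) (hβ : |β'| < 1 / 12)
    (κ : ℝ≥0 → Kernel (GaugeConfig 3 L (Matrix.specialUnitaryGroup (Fin 2) ℂ))
      (GaugeConfig 3 L (Matrix.specialUnitaryGroup (Fin 2) ℂ))) [∀ t, IsMarkovKernel (κ t)]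
    (hreal : ∀ (t : ℝ≥0) (x : GaugeConfig 3 L (Matrix.specialUnitaryGroup (Fin 2) ℂ))
        (Ω : Type) [MeasurableSpace Ω] (P : Measure Ω) [IsProbabilityMeasure P]
        (W : ℝ≥0 → Ω → (Edge 3 L × NoiseIdx 2 → ℝ)) (hW : IsFlatBrownian W P)
        (U : ℝ≥0 → Ω → GaugeConfig 3 L (Matrix.specialUnitaryGroup (Fin 2) ℂ)),
        (∀ ω, U 0 ω = x) →
        (latticeLangevinDynamics (fundamentalLatticeRep 2) β').IsSolution (fundamentalRep (Fin 2))
          hW.natFiltration P W U →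
        κ t x = P.map (U t))
    (ν : Measure (GaugeConfig 3 L (Matrix.specialUnitaryGroup (Fin 2) ℂ))) [IsProbabilityMeasure ν]
    (hfin : klDiv ν (wilsonMeasure (d := 3) (L := L) (fundamentalRep (Fin 2)) β') ≠ ∞)
    {A : Set (GaugeConfig 3 L (Matrix.specialUnitaryGroup (Fin 2) ℂ))} (hA : MeasurableSet A) {s : ℝ≥0} (hs : 0 < (s : ℝ)) (t : ℝ≥0) :
    |((κ (t + s) ∘ₘ ν) A).toReal - ((wilsonMeasure (d := 3) (L := L) (fundamentalRep (Fin 2)) β') A).toReal| ≤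
      Real.sqrt ((1 - 12 * |β'|) / (Real.exp (2 * (1 - 12 * |β'|) * (s : ℝ)) - 1)) * Real.exp (-((1 - 12 * |β'|) * (t : ℝ))) *
        Real.sqrt (2 * (1 / (1 - 12 * |β'|)) * (klDiv ν (wilsonMeasure (d := 3) (L := L) (fundamentalRep (Fin 2)) β')).toReal) := by
  classical
  haveI := secondCountableTopology_su2
  haveI := borelSpace_config L
  haveI : IsProbabilityMeasure (wilsonMeasure (d := 3) (L := L) (fundamentalRep (Fin 2)) β') :=
    isProbabilityMeasure_wilsonMeasure (d := 3) (L := L) (fundamentalRep (Fin 2)) (continuous_fundamentalRep (Fin 2)) β'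
  have hc : 0 < 1 - 12 * |β'| := by linarith
  have hden : 0 < Real.exp (2 * (1 - 12 * |β'|) * (s : ℝ)) - 1 := by
    have : 1 < Real.exp (2 * (1 - 12 * |β'|) * (s : ℝ)) := Real.one_lt_exp_iff.2 (by positivity)
    linarith
  have hinv : κ (t + s) ∘ₘ (wilsonMeasure (d := 3) (L := L) (fundamentalRep (Fin 2)) β') = wilsonMeasure (d := 3) (L := L) (fundamentalRep (Fin 2)) β' :=
    (wilson_invariant_of_fact L β' (wilsonMeasureLangevinInvariant_su2 L β') κ hreal (t + s)).def
  have h1 := wilson_tv_contraction_szzWasserstein_W2 L β' hβ κ hreal ν (wilsonMeasure (d := 3) (L := L) (fundamentalRep (Fin 2)) β') hA hs t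
  rw [hinv] at h1
  have h2 := h1.trans (wilson_talagrand_T2 L β' hβ ν hfin)
  have hKL0 : 0 ≤ 2 * (1 / (1 - 12 * |β'|)) * (klDiv ν (wilsonMeasure (d := 3) (L := L) (fundamentalRep (Fin 2)) β')).toReal := by positivity
  rw [ENNReal.ofReal_le_ofReal_iff hKL0] at h2
  have hK0 : 0 < (1 - 12 * |β'|) / (Real.exp (2 * (1 - 12 * |β'|) * (s : ℝ)) - 1) * Real.exp (-(2 * (1 - 12 * |β'|) * (t : ℝ))) :=
    mul_pos (div_pos hc hden) (Real.exp_pos _)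
  rw [div_le_iff₀ hK0] at h2
  have hx0 : 0 ≤ |((κ (t + s) ∘ₘ ν) A).toReal - ((wilsonMeasure (d := 3) (L := L) (fundamentalRep (Fin 2)) β') A).toReal| := abs_nonneg _
  have hE : Real.sqrt (Real.exp (-(2 * (1 - 12 * |β'|) * (t : ℝ)))) = Real.exp (-((1 - 12 * |β'|) * (t : ℝ))) := by
    rw [show Real.exp (-(2 * (1 - 12 * |β'|) * (t : ℝ))) = Real.exp (-((1 - 12 * |β'|) * (t : ℝ))) ^ 2 by rw [sq, ← Real.exp_add]; ring_nf]
    exact Real.sqrt_sq (Real.exp_pos _).le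
  calc |((κ (t + s) ∘ₘ ν) A).toReal - ((wilsonMeasure (d := 3) (L := L) (fundamentalRep (Fin 2)) β') A).toReal|
      = Real.sqrt (|((κ (t + s) ∘ₘ ν) A).toReal - ((wilsonMeasure (d := 3) (L := L) (fundamentalRep (Fin 2)) β') A).toReal| ^ 2) := (Real.sqrt_sq hx0).symm
    _ ≤ Real.sqrt ((2 * (1 / (1 - 12 * |β'|)) * (klDiv ν (wilsonMeasure (d := 3) (L := L) (fundamentalRep (Fin 2)) β')).toReal) *
        ((1 - 12 * |β'|) / (Real.exp (2 * (1 - 12 * |β'|) * (s : ℝ)) - 1) * Real.exp (-(2 * (1 - 12 * |β'|) * (t : ℝ))))) := Real.sqrt_le_sqrt h2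
    _ = _ := by
        rw [Real.sqrt_mul hKL0, Real.sqrt_mul (div_pos hc hden).le, hE]; ring

end Summit.QuantumFields.YangMills.Theorems.ColdStartUniversality

end
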